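import Summits.QuantumFields.YangMills.Theorems.UnitScaleTiltProp7CombVsAxialTransport
import Summits.QuantumFields.YangMills.Theorems.UnitScaleTiltProp7CornerFrameLegsLetters
import Summits.QuantumFields.YangMills.Theorems.UnitScaleTiltProp7TentProfileZd
import Literature.MathematicalPhysics.QuantumFieldTheory.Balaban1983to89.B8Ineq132
import HarnessLib

/-!
# Route `UnitScaleTilt`, crux K1 (stmt-QuantumFields-19200), stub `stub_existenceMinimalOrbit` (EX), LANE II «divergence recovery at curved `W`» (★★OWNER RULING №23),
# (B7) `hRows` input list, NAMER WORD №13 [I-5] — **THE CONVERSION ROW: PLAIN ∕ AXIAL-GAUGE BLOCK MEANS ⟷ PRINT'S HIERARCHICAL COMB MEANS `Q′_k`, WITH `Ū`-DIFFERENCES**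
Cell `ym3-torus`, width seat `ym3-torus-px5` (gen 7).  THEOREMS ONLY (0 `def`, 0 `sorry`); `--supports stmt-QuantumFields-19200 --as helper`, count-neutral.
YM₃ on T³ is a ladder rung (R3), not the Clay problem; nothing here claims the stub, the crux, d = 4 or the mass gap.
OBJECTS (on `ℤᵈ`, the letters of ✓`Prop7CombVsAxialTransport` and of px4 g7's (B9d) «flat in the axial gauge»).  `V : ℤᵈ → 𝔸ˣ` unit-bounded with all plaquettes
`a`-close to `1`; a cube rooted at `lo` with its axial gauge `u := axialFn V lo` (px4's `w := Ad(u)φ`); blocks `B_ℓ(b) = blockSites ℓ b` with corners `x_b = blockBase ℓ b ≥ lo`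
inside the cube (`x − lo ≤ Rtot` coordinatewise on the block); the PLAIN block mean of `w`, `A_b := Σ_{x ∈ B_ℓ(b)} ω • Ad(u x)(φ x)` (`ω = ℓ^{−d}`); a block transporter family
`T_b x` from the corner (`‖T_b x − axialFn V x_b x‖ ≤ θ` — print's comb transporter `compT L (bgT L V) k b x` by ✓`norm_compT_bgT_sub_axialFn_le`, `θ = 87d(d+1)(d+4)α₀`) and its
covariant mean `Q_b := Σ_{x ∈ B_ℓ(b)} ω • Ad(T_b x)(φ x)` (= `(Q′_k φ)(b)` by lit ✓`QprimeIter_zd_eq_sum_blockIter`); (`Ad` is `2`-Lipschitz on `U1`: w4-20520's ✓`Prop7CornerFrameLegsLetters.norm_conjR_sub_conjR_le`); a coarse bond variable `Ū ∈ U1` with `‖Ū − V(x_b → x_b + ℓe_μ)‖ ≤ E`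
(the route's `descendToGL`, (B3c) ✓`Prop7DescentStraightCloseness`).
THE ROWS.  §3 pointwise: `‖Q_b − Ad(u x_b)⁻¹ A_b‖ ≤ 2(θ + κ)·Σ ω‖φ‖` with `κ := d(ℓ−1)·(d·Rtot)·a` (the re-rooting of the axial tree from `lo` to `x_b`, ✓`norm_axialFn_mul_axialFn_sub_axialFn_le`);
§4 bondwise: `‖(Ad(Ū)Q_{b+e_μ} − Q_b) − Ad(u x_b)⁻¹(A_{b+e_μ} − A_b)‖ ≤ 2(E + ℓ·(d·Rtot)·a)·Σ_{b+e_μ} ω‖φ‖ + (both §3 errors)`; §2 the squared ∕ summed forms in both directions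
(mass: `Σ_b‖Q_b‖² ≤ 2Σ_b‖A_b‖² + 2γ²·ω·Σ_bΣ_{B(b)}‖φ‖²` and conversely; gradient: the same with the bond errors) — the `h8`-slot currency conversion «plain∕axial means →
hierarchical `Q′` means with `Ū` differences» of NAMER WORD №13 [I-5], at cost `(R·α₀)²·(fine mass)` (`κ`, `ℓ(dRtot)a` are `O(R·α₀)` for `a < α₀ℓ⁻²`, `Rtot = O(Rℓ)`).
§5: print's comb transporter plugged in (`T_b x := compT L (bgT L V) k b x`, F3), in `QprimeIter (zdBlocking d L) (bgT L V) k` letters (= `QprimeCombL2_apply`'s).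
HONEST SCOPE.  Lattice holonomy ∕ finite-sum bookkeeping over landed theorems; no new analytic estimate; the member reading (`V := W♯`, `α₀ := 2e`, `E := CT·e` from `RegPr`,
`QprimeCombL2`, `descendToGL`) is (a′)'s ∕ the consumer's.  Nothing of (B9d), (REC), `hRows`, `hN06`, the stub or the crux here.
References: T. Bałaban, CMP 99 (1985) 389–434 [Balaban1985BackgroundPropagators] ((3.19) p.393, (3.24)–(3.26) pp.394–395); CMP 98 (1985) 17–51 [Balaban1985Averaging]
((42)–(43) pp.23–24, pp.24–25, (52)–(54) p.26, (78)–(80) p.30); CMP 99 (1985) 75–102 [Balaban1985RegularSpaces] ((1.70) p.88).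
-/

set_option autoImplicit false
noncomputable section
open scoped BigOperators

namespace Summit.QuantumFields.YangMills.Theorems.Prop7CombVsAxialMeans

open Literature.MathematicalPhysics.QuantumFieldTheory.Balaban1983to89
open Literature.MathematicalPhysics.QuantumLattice (blockMap blockBase blockSites mem_blockSites_iff card_blockSites blockMap_blockBase)
open B7Prop1Explicit (Site Letter e e_apply hol seg treeWord axialFn U1 l1 mem_U1 hol_mem axialFn_mem plaqWord)
open B7Prop2Explicit (pdev le_pdev pdev_nonneg C0 c2' AvgClosed avgIter avgIter_mem)
open B7Eq78Linearization (conjR conjR_apply conjR_sub conjR_add conjR_smul_real QprimeIter zdBlocking)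
open B8Eq119TwistedAxial (bgT)
open B8Ineq132 (norm_conjR norm_conjR_le conjR_conjR conjR_sum)
open B8Lemma1NonAbelian (treeWord_zsmul_e)
open B9B8AveragingKernelZd (blockIter compT mem_blockIter_iff QprimeIter_zd_eq_sum_blockIter)
open Summit.QuantumFields.YangMills.Theorems.Prop7CornerFrameLegsLetters (norm_conjR_sub_conjR_le)
open Summit.QuantumFields.YangMills.Theorems.Prop7TentProfileZd (blockIter_eq_blockSites_pow)
open Summit.QuantumFields.YangMills.Theorems.Prop7CombVsAxialTransport
  (norm_axialFn_mul_axialFn_sub_axialFn_le exists_offset_of_mem_blockSites iterate_blockMap_eq l1_le_mul_of_le norm_compT_bgT_sub_axialFn_le)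

variable {d : ℕ} {𝔸 : Type*} [NormedRing 𝔸] [NormOneClass 𝔸]

/-! ## §1 Letters -/

/-- re-rooting a unit transporter: `‖c⁻¹·y − A‖ ≤ ‖y − c·A‖` for `c ∈ U1` (`c⁻¹y − A = c⁻¹(y − cA)`). [folklore] -/
theorem norm_inv_mul_sub_le {c : 𝔸ˣ} (hc : c ∈ U1 𝔸) (y A : 𝔸) :
    ‖((c⁻¹ : 𝔸ˣ) : 𝔸) * y - A‖ ≤ ‖y - (c : 𝔸) * A‖ := by
  have e1 : ((c⁻¹ : 𝔸ˣ) : 𝔸) * y - A = ((c⁻¹ : 𝔸ˣ) : 𝔸) * (y - (c : 𝔸) * A) := by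
    rw [mul_sub, ← mul_assoc, Units.inv_mul, one_mul]
  rw [e1]
  exact (norm_mul_le _ _).trans (mul_le_of_le_one_left (norm_nonneg _) (mem_U1.1 hc).2)

/-- `‖Ū·c′⁻¹ − c⁻¹‖ ≤ ‖Ū − c⁻¹·c′‖` for `c′ ∈ U1` (`Ūc′⁻¹ − c⁻¹ = (Ū − c⁻¹c′)c′⁻¹`). [folklore] -/
theorem norm_mul_inv_sub_inv_le {c c' : 𝔸ˣ} (hc' : c' ∈ U1 𝔸) (U : 𝔸) :
    ‖U * ((c'⁻¹ : 𝔸ˣ) : 𝔸) - ((c⁻¹ : 𝔸ˣ) : 𝔸)‖ ≤ ‖U - ((c⁻¹ : 𝔸ˣ) : 𝔸) * (c' : 𝔸)‖ := by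
  have e1 : U * ((c'⁻¹ : 𝔸ˣ) : 𝔸) - ((c⁻¹ : 𝔸ˣ) : 𝔸) = (U - ((c⁻¹ : 𝔸ˣ) : 𝔸) * (c' : 𝔸)) * ((c'⁻¹ : 𝔸ˣ) : 𝔸) := by
    rw [sub_mul, mul_assoc, Units.mul_inv, mul_one]
  rw [e1]
  exact (norm_mul_le _ _).trans (mul_le_of_le_one_right (norm_nonneg _) (mem_U1.1 hc').2)

/-- a block site sits above its corner with offset `≤ ℓ − 1` coordinatewise: `x_b ≤ x`, `|x − x_b|₁ ≤ d(ℓ−1)`. [cite: Balaban1985Averaging, (2) p.17] -/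
theorem blockBase_le_and_l1_le {ℓ : ℕ} {b x : Site d} (hx : x ∈ blockSites ℓ b) :
    blockBase ℓ b ≤ x ∧ l1 (x - blockBase ℓ b) ≤ d * (ℓ - 1) := by
  obtain ⟨t, ht, rfl⟩ := exists_offset_of_mem_blockSites hx
  have ht0 : (0 : Site d) ≤ fun i => (t i : ℤ) := fun i => by simp
  refine ⟨le_add_of_nonneg_right ht0, ?_⟩
  rw [add_sub_cancel_left]
  exact l1_le_mul_of_le ht0 fun i => by have := ht i; show (t i : ℤ) ≤ ((ℓ - 1 : ℕ) : ℤ); omega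

/-- the corner of a block lies in the block (`ℓ ≥ 1`). [cite: Balaban1985Averaging, (2) p.17] -/
theorem blockBase_mem_blockSites' {ℓ : ℕ} (hℓ : 1 ≤ ℓ) (b : Site d) : blockBase ℓ b ∈ blockSites ℓ b := by
  haveI : NeZero ℓ := ⟨by omega⟩
  rw [mem_blockSites_iff, blockMap_blockBase]

/-- the next block corner in direction `μ`: `blockBase ℓ (b + e μ) = blockBase ℓ b + ℓ • e μ`. [folklore] -/
theorem blockBase_add_e (ℓ : ℕ) (b : Site d) (μ : Fin d) : blockBase ℓ (b + e μ) = blockBase ℓ b + (ℓ : ℤ) • e μ := by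
  funext i; simp only [blockBase, Pi.add_apply, Pi.smul_apply, smul_eq_mul, mul_add]

/-- `|ℓ•e_μ|₁ = ℓ`. [folklore] -/
theorem l1_natCast_smul_e (ℓ : ℕ) (μ : Fin d) : l1 ((ℓ : ℤ) • e μ : Site d) = ℓ := by
  unfold l1
  have h : ∀ κ : Fin d, (((ℓ : ℤ) • e μ : Site d) κ).natAbs = if κ = μ then ℓ else 0 := fun κ => by
    rw [Pi.smul_apply, e_apply, smul_eq_mul]
    split_ifs <;> simp
  simp_rw [h]
  rw [Finset.sum_ite_eq' Finset.univ μ (fun _ => ℓ)]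
  simp

omit [NormOneClass 𝔸] in
/-- the axial transporter to the next corner is the straight segment: `axialFn V c (c + ℓ•e_μ) = V(c; ℓ steps e_μ)`. [cite: Balaban1985Averaging, p.24] -/
theorem axialFn_add_smul_e (V : Site d → Fin d → 𝔸ˣ) (c : Site d) (ℓ : ℕ) (μ : Fin d) :
    axialFn V c (c + (ℓ : ℤ) • e μ) = hol V c (seg μ (ℓ : ℤ)) := by
  show hol V c (treeWord (c + (ℓ : ℤ) • e μ - c)) = _
  rw [add_sub_cancel_left, treeWord_zsmul_e]

/-- Jensen for the uniform block weight: `(Σ_{x∈s} ω·a x)² ≤ ω·Σ_{x∈s} (a x)²` when `ω·#s = 1`. [folklore] -/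
theorem sq_sum_smul_le {ι : Type*} (s : Finset ι) {ω : ℝ} (hωs : ω * s.card = 1) (a : ι → ℝ) :
    (∑ x ∈ s, ω * a x) ^ 2 ≤ ω * ∑ x ∈ s, a x ^ 2 := by
  rw [← Finset.mul_sum, mul_pow]
  calc ω ^ 2 * (∑ x ∈ s, a x) ^ 2 ≤ ω ^ 2 * (s.card * ∑ x ∈ s, a x ^ 2) :=
        mul_le_mul_of_nonneg_left sq_sum_le_card_mul_sum_sq (sq_nonneg _)
    _ = ω * (ω * s.card) * ∑ x ∈ s, a x ^ 2 := by ring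
    _ = _ := by rw [hωs, mul_one]

/-- `p² ≤ 2(q² + r²)` from `0 ≤ p ≤ q + r` (a norm split, squared). [folklore] -/
theorem sq_le_two_mul_sq_add_sq_of_le_add {p q r : ℝ} (hp : 0 ≤ p) (h : p ≤ q + r) : p ^ 2 ≤ 2 * (q ^ 2 + r ^ 2) := by
  have h2 : p ^ 2 ≤ (q + r) ^ 2 := pow_le_pow_left₀ hp h 2
  nlinarith [sq_nonneg (q - r)]

/-! ## §2 Squared and summed: the currency conversions in both directions (pure bookkeeping) -/

/-- ★★ **MASS CONVERSION (both directions)**: over any finite set `P` of blocks, if blockwise `‖Q_b − Ad(c_b)A_b‖ ≤ γ·Σ_{B(b)} ω‖φ‖` with `c_b ∈ U1` and `ω·#B(b) = 1`, then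
`Σ_{b∈P}‖Q_b‖² ≤ 2Σ_{b∈P}‖A_b‖² + 2γ²·ω·Σ_{b∈P}Σ_{B(b)}‖φ‖²` and `Σ_{b∈P}‖A_b‖² ≤ 2Σ_{b∈P}‖Q_b‖² + 2γ²·ω·Σ_{b∈P}Σ_{B(b)}‖φ‖²`.
[cite: Balaban1985BackgroundPropagators, (3.24)–(3.26) pp.394–395] -/
theorem sum_sq_covMean_le_and_ge (P : Finset (Site d)) (B : Site d → Finset (Site d)) {ω : ℝ} (hωB : ∀ b ∈ P, ω * (B b).card = 1)
    (Q A : Site d → 𝔸) (c : Site d → 𝔸ˣ) (hc : ∀ b ∈ P, c b ∈ U1 𝔸) (φ : Site d → 𝔸) {γ : ℝ}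
    (hrow : ∀ b ∈ P, ‖Q b - conjR (c b) (A b)‖ ≤ γ * ∑ x ∈ B b, ω * ‖φ x‖) :
    ∑ b ∈ P, ‖Q b‖ ^ 2 ≤ 2 * ∑ b ∈ P, ‖A b‖ ^ 2 + 2 * γ ^ 2 * (ω * ∑ b ∈ P, ∑ x ∈ B b, ‖φ x‖ ^ 2) ∧
    ∑ b ∈ P, ‖A b‖ ^ 2 ≤ 2 * ∑ b ∈ P, ‖Q b‖ ^ 2 + 2 * γ ^ 2 * (ω * ∑ b ∈ P, ∑ x ∈ B b, ‖φ x‖ ^ 2) := by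
  have hm : ∀ b ∈ P, (γ * ∑ x ∈ B b, ω * ‖φ x‖) ^ 2 ≤ γ ^ 2 * (ω * ∑ x ∈ B b, ‖φ x‖ ^ 2) := fun b hb => by
    rw [mul_pow]; exact mul_le_mul_of_nonneg_left (sq_sum_smul_le (B b) (hωB b hb) _) (sq_nonneg _)
  have hQ : ∀ b ∈ P, ‖Q b‖ ≤ ‖A b‖ + γ * ∑ x ∈ B b, ω * ‖φ x‖ := fun b hb => by
    calc ‖Q b‖ = ‖conjR (c b) (A b) + (Q b - conjR (c b) (A b))‖ := by rw [add_sub_cancel]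
      _ ≤ ‖conjR (c b) (A b)‖ + ‖Q b - conjR (c b) (A b)‖ := norm_add_le _ _
      _ ≤ _ := by rw [norm_conjR (hc b hb)]; exact add_le_add le_rfl (hrow b hb)
  have hA : ∀ b ∈ P, ‖A b‖ ≤ ‖Q b‖ + γ * ∑ x ∈ B b, ω * ‖φ x‖ := fun b hb => by
    calc ‖A b‖ = ‖conjR (c b) (A b)‖ := (norm_conjR (hc b hb) _).symm
      _ = ‖Q b - (Q b - conjR (c b) (A b))‖ := by rw [sub_sub_cancel]
      _ ≤ ‖Q b‖ + ‖Q b - conjR (c b) (A b)‖ := norm_sub_le _ _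
      _ ≤ _ := add_le_add le_rfl (hrow b hb)
  have hsum : ∀ (X Y : Site d → 𝔸), (∀ b ∈ P, ‖X b‖ ≤ ‖Y b‖ + γ * ∑ x ∈ B b, ω * ‖φ x‖) →
      ∑ b ∈ P, ‖X b‖ ^ 2 ≤ 2 * ∑ b ∈ P, ‖Y b‖ ^ 2 + 2 * γ ^ 2 * (ω * ∑ b ∈ P, ∑ x ∈ B b, ‖φ x‖ ^ 2) := by
    intro X Y hXY
    calc ∑ b ∈ P, ‖X b‖ ^ 2 ≤ ∑ b ∈ P, (2 * ‖Y b‖ ^ 2 + 2 * (γ ^ 2 * (ω * ∑ x ∈ B b, ‖φ x‖ ^ 2))) :=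
          Finset.sum_le_sum fun b hb => (sq_le_two_mul_sq_add_sq_of_le_add (norm_nonneg _) (hXY b hb)).trans (by linarith [hm b hb])
      _ = _ := by simp only [Finset.sum_add_distrib, ← Finset.mul_sum]; ring
  exact ⟨hsum Q A hQ, hsum A Q hA⟩

/-- ★★ **GRADIENT CONVERSION (both directions)**: over any finite set `C` of coarse bonds `(b, μ)`, if bondwise `‖X_{b,μ} − Ad(c_b)Y_{b,μ}‖ ≤ γ′·Σ_{B(b+e_μ)} ω‖φ‖ + γ·Σ_{B(b)} ω‖φ‖`
(`X` = the `Ū`-difference of covariant means, `Y` = the flat difference of plain∕axial means, §4), `c_b ∈ U1`, `ω·#B(·) = 1`, then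
`Σ_C‖X‖² ≤ 2Σ_C‖Y‖² + 4ω·(γ′²·Σ_CΣ_{B(b+e_μ)}‖φ‖² + γ²·Σ_CΣ_{B(b)}‖φ‖²)` and the same with `X`, `Y` exchanged.
[cite: Balaban1985BackgroundPropagators, (3.24)–(3.26) pp.394–395] -/
theorem sum_sq_covDiff_le_and_ge (C : Finset (Site d × Fin d)) (B : Site d → Finset (Site d)) {ω : ℝ}
    (hωB : ∀ q ∈ C, ω * (B q.1).card = 1) (hωB' : ∀ q ∈ C, ω * (B (q.1 + e q.2)).card = 1)
    (X Y : Site d × Fin d → 𝔸) (c : Site d → 𝔸ˣ) (hc : ∀ q ∈ C, c q.1 ∈ U1 𝔸) (φ : Site d → 𝔸) {γ γ' : ℝ}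
    (hrow : ∀ q ∈ C, ‖X q - conjR (c q.1) (Y q)‖ ≤ γ' * ∑ x ∈ B (q.1 + e q.2), ω * ‖φ x‖ + γ * ∑ x ∈ B q.1, ω * ‖φ x‖) :
    ∑ q ∈ C, ‖X q‖ ^ 2 ≤ 2 * ∑ q ∈ C, ‖Y q‖ ^ 2
        + 4 * ω * (γ' ^ 2 * ∑ q ∈ C, ∑ x ∈ B (q.1 + e q.2), ‖φ x‖ ^ 2 + γ ^ 2 * ∑ q ∈ C, ∑ x ∈ B q.1, ‖φ x‖ ^ 2) ∧
    ∑ q ∈ C, ‖Y q‖ ^ 2 ≤ 2 * ∑ q ∈ C, ‖X q‖ ^ 2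
        + 4 * ω * (γ' ^ 2 * ∑ q ∈ C, ∑ x ∈ B (q.1 + e q.2), ‖φ x‖ ^ 2 + γ ^ 2 * ∑ q ∈ C, ∑ x ∈ B q.1, ‖φ x‖ ^ 2) := by
  have hm : ∀ q ∈ C, (γ' * ∑ x ∈ B (q.1 + e q.2), ω * ‖φ x‖ + γ * ∑ x ∈ B q.1, ω * ‖φ x‖) ^ 2
      ≤ 2 * (γ' ^ 2 * (ω * ∑ x ∈ B (q.1 + e q.2), ‖φ x‖ ^ 2)) + 2 * (γ ^ 2 * (ω * ∑ x ∈ B q.1, ‖φ x‖ ^ 2)) := fun q hq => by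
    have h1 : (γ' * ∑ x ∈ B (q.1 + e q.2), ω * ‖φ x‖) ^ 2 ≤ γ' ^ 2 * (ω * ∑ x ∈ B (q.1 + e q.2), ‖φ x‖ ^ 2) := by
      rw [mul_pow]; exact mul_le_mul_of_nonneg_left (sq_sum_smul_le _ (hωB' q hq) _) (sq_nonneg _)
    have h2 : (γ * ∑ x ∈ B q.1, ω * ‖φ x‖) ^ 2 ≤ γ ^ 2 * (ω * ∑ x ∈ B q.1, ‖φ x‖ ^ 2) := by
      rw [mul_pow]; exact mul_le_mul_of_nonneg_left (sq_sum_smul_le _ (hωB q hq) _) (sq_nonneg _)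
    nlinarith [sq_nonneg (γ' * ∑ x ∈ B (q.1 + e q.2), ω * ‖φ x‖ - γ * ∑ x ∈ B q.1, ω * ‖φ x‖)]
  have hX : ∀ q ∈ C, ‖X q‖ ≤ ‖Y q‖ + (γ' * ∑ x ∈ B (q.1 + e q.2), ω * ‖φ x‖ + γ * ∑ x ∈ B q.1, ω * ‖φ x‖) := fun q hq => by
    calc ‖X q‖ = ‖conjR (c q.1) (Y q) + (X q - conjR (c q.1) (Y q))‖ := by rw [add_sub_cancel]
      _ ≤ ‖conjR (c q.1) (Y q)‖ + ‖X q - conjR (c q.1) (Y q)‖ := norm_add_le _ _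
      _ ≤ _ := by rw [norm_conjR (hc q hq)]; exact add_le_add le_rfl (hrow q hq)
  have hY : ∀ q ∈ C, ‖Y q‖ ≤ ‖X q‖ + (γ' * ∑ x ∈ B (q.1 + e q.2), ω * ‖φ x‖ + γ * ∑ x ∈ B q.1, ω * ‖φ x‖) := fun q hq => by
    calc ‖Y q‖ = ‖conjR (c q.1) (Y q)‖ := (norm_conjR (hc q hq) _).symm
      _ = ‖X q - (X q - conjR (c q.1) (Y q))‖ := by rw [sub_sub_cancel]
      _ ≤ ‖X q‖ + ‖X q - conjR (c q.1) (Y q)‖ := norm_sub_le _ _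
      _ ≤ _ := add_le_add le_rfl (hrow q hq)
  have hsum : ∀ (X' Y' : Site d × Fin d → 𝔸),
      (∀ q ∈ C, ‖X' q‖ ≤ ‖Y' q‖ + (γ' * ∑ x ∈ B (q.1 + e q.2), ω * ‖φ x‖ + γ * ∑ x ∈ B q.1, ω * ‖φ x‖)) →
      ∑ q ∈ C, ‖X' q‖ ^ 2 ≤ 2 * ∑ q ∈ C, ‖Y' q‖ ^ 2
        + 4 * ω * (γ' ^ 2 * ∑ q ∈ C, ∑ x ∈ B (q.1 + e q.2), ‖φ x‖ ^ 2 + γ ^ 2 * ∑ q ∈ C, ∑ x ∈ B q.1, ‖φ x‖ ^ 2) := by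
    intro X' Y' hXY
    calc ∑ q ∈ C, ‖X' q‖ ^ 2 ≤ ∑ q ∈ C, (2 * ‖Y' q‖ ^ 2
          + (4 * (γ' ^ 2 * (ω * ∑ x ∈ B (q.1 + e q.2), ‖φ x‖ ^ 2)) + 4 * (γ ^ 2 * (ω * ∑ x ∈ B q.1, ‖φ x‖ ^ 2)))) :=
          Finset.sum_le_sum fun q hq => (sq_le_two_mul_sq_add_sq_of_le_add (norm_nonneg _) (hXY q hq)).trans (by linarith [hm q hq])
      _ = _ := by simp only [Finset.sum_add_distrib, ← Finset.mul_sum]; ring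
  exact ⟨hsum X Y hX, hsum Y X hY⟩

/-! ## §3 Pointwise: the covariant block mean against the conjugated plain∕axial block mean -/

variable {V : Site d → Fin d → 𝔸ˣ} {a : ℝ}

/-- ★ **RE-ROOTING THE AXIAL TREE**: for `lo ≤ c ≤ x` with `x − lo ≤ Rtot` coordinatewise, `‖(axialFn V lo c)⁻¹·axialFn V lo x − axialFn V c x‖ ≤ |x − c|₁·(d·Rtot)·a`
(✓`norm_axialFn_mul_axialFn_sub_axialFn_le` re-rooted through `norm_inv_mul_sub_le`). [cite: Balaban1985Averaging, pp.24–25; Balaban1985RegularSpaces, (1.70) p.88] -/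
theorem norm_inv_axialFn_mul_axialFn_sub_le (hV : ∀ x κ, V x κ ∈ U1 𝔸) (ha : 0 ≤ a)
    (hP : ∀ (x : Site d) (κ μ : Fin d), κ ≠ μ → ‖((hol V x (plaqWord κ μ) : 𝔸ˣ) : 𝔸) - 1‖ ≤ a)
    (lo c x : Site d) (hloc : lo ≤ c) (hcx : c ≤ x) {Rtot : ℕ} (hR : ∀ i, x i - lo i ≤ Rtot) :
    ‖(((axialFn V lo c)⁻¹ * axialFn V lo x : 𝔸ˣ) : 𝔸) - ((axialFn V c x : 𝔸ˣ) : 𝔸)‖ ≤ (l1 (x - c) : ℝ) * ((d * Rtot) * a) := by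
  have h := norm_axialFn_mul_axialFn_sub_axialFn_le hV ha hP lo c x hloc hcx hR
  have hc1 : axialFn V lo c ∈ U1 𝔸 := axialFn_mem hV _ _
  rw [Units.val_mul]
  refine (norm_inv_mul_sub_le hc1 _ _).trans ?_
  rw [norm_sub_rev, ← Units.val_mul]
  exact h

variable [NormedAlgebra ℂ 𝔸]

/-- ★★ **THE POINTWISE CONVERSION ROW**: block `B_ℓ(b)` with corner `x_b = blockBase ℓ b ≥ lo` inside the cube (`x − lo ≤ Rtot` on the block), block transporters `T x ∈ U1` with
`‖T x − axialFn V x_b x‖ ≤ θ` on the block; then for every `φ` and weight `ω ≥ 0`: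
`‖Σ_{B(b)} ω•Ad(T x)(φ x) − Ad(u x_b)⁻¹(Σ_{B(b)} ω•Ad(u x)(φ x))‖ ≤ 2(θ + d(ℓ−1)·(d·Rtot)·a)·Σ_{B(b)} ω‖φ x‖`, `u = axialFn V lo`.
[cite: Balaban1985BackgroundPropagators, (3.19) p.393; Balaban1985Averaging, pp.24–25] -/
theorem norm_covMean_sub_conj_axialMean_le (hV : ∀ x κ, V x κ ∈ U1 𝔸) (ha : 0 ≤ a)
    (hP : ∀ (x : Site d) (κ μ : Fin d), κ ≠ μ → ‖((hol V x (plaqWord κ μ) : 𝔸ˣ) : 𝔸) - 1‖ ≤ a)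
    (lo : Site d) (ℓ : ℕ) (b : Site d) (hlo : lo ≤ blockBase ℓ b) {Rtot : ℕ} (hR : ∀ x ∈ blockSites ℓ b, ∀ i, x i - lo i ≤ Rtot)
    (T : Site d → 𝔸ˣ) (hT1 : ∀ x ∈ blockSites ℓ b, T x ∈ U1 𝔸) {θ : ℝ} (hT : ∀ x ∈ blockSites ℓ b, ‖((T x : 𝔸ˣ) : 𝔸) - ((axialFn V (blockBase ℓ b) x : 𝔸ˣ) : 𝔸)‖ ≤ θ)
    (φ : Site d → 𝔸) {ω : ℝ} (hω : 0 ≤ ω) :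
    ‖∑ x ∈ blockSites ℓ b, ω • conjR (T x) (φ x) - conjR (axialFn V lo (blockBase ℓ b))⁻¹ (∑ x ∈ blockSites ℓ b, ω • conjR (axialFn V lo x) (φ x))‖
      ≤ 2 * (θ + (d * (ℓ - 1 : ℕ) : ℝ) * ((d * Rtot) * a)) * ∑ x ∈ blockSites ℓ b, ω * ‖φ x‖ := by
  set c := axialFn V lo (blockBase ℓ b) with hc
  have hc1 : c ∈ U1 𝔸 := axialFn_mem hV _ _
  have hci : c⁻¹ ∈ U1 𝔸 := (U1 𝔸).inv_mem hc1
  set γ : ℝ := θ + (d * (ℓ - 1 : ℕ) : ℝ) * ((d * Rtot) * a) with hγ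
  rw [conjR_sum, ← Finset.sum_sub_distrib]
  have hterm : ∀ x ∈ blockSites ℓ b, ‖ω • conjR (T x) (φ x) - conjR c⁻¹ (ω • conjR (axialFn V lo x) (φ x))‖ ≤ ω * (2 * γ * ‖φ x‖) := by
    intro x hx
    rw [conjR_smul_real, conjR_conjR, ← smul_sub, norm_smul, Real.norm_of_nonneg hω]
    refine mul_le_mul_of_nonneg_left ?_ hω
    have hux : c⁻¹ * axialFn V lo x ∈ U1 𝔸 := (U1 𝔸).mul_mem hci (axialFn_mem hV _ _)
    refine (norm_conjR_sub_conjR_le (hT1 x hx) hux (φ x)).trans ?_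
    have hκ : ‖((T x : 𝔸ˣ) : 𝔸) - ((c⁻¹ * axialFn V lo x : 𝔸ˣ) : 𝔸)‖ ≤ γ := by
      obtain ⟨hbx, hl1⟩ := blockBase_le_and_l1_le hx
      have h2 := norm_inv_axialFn_mul_axialFn_sub_le hV ha hP lo (blockBase ℓ b) x hlo hbx (hR x hx)
      have h3 : (l1 (x - blockBase ℓ b) : ℝ) * ((d * Rtot) * a) ≤ (d * (ℓ - 1 : ℕ) : ℝ) * ((d * Rtot) * a) := by
        refine mul_le_mul_of_nonneg_right ?_ (by positivity)
        exact_mod_cast hl1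
      calc _ ≤ ‖((T x : 𝔸ˣ) : 𝔸) - ((axialFn V (blockBase ℓ b) x : 𝔸ˣ) : 𝔸)‖
            + ‖((axialFn V (blockBase ℓ b) x : 𝔸ˣ) : 𝔸) - ((c⁻¹ * axialFn V lo x : 𝔸ˣ) : 𝔸)‖ := norm_sub_le_norm_sub_add_norm_sub _ _ _
        _ ≤ θ + (l1 (x - blockBase ℓ b) : ℝ) * ((d * Rtot) * a) := add_le_add (hT x hx) (by rw [norm_sub_rev]; exact h2)
        _ ≤ γ := by rw [hγ]; linarith
    exact mul_le_mul_of_nonneg_right (mul_le_mul_of_nonneg_left hκ (by norm_num)) (norm_nonneg _)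
  calc _ ≤ ∑ x ∈ blockSites ℓ b, ‖ω • conjR (T x) (φ x) - conjR c⁻¹ (ω • conjR (axialFn V lo x) (φ x))‖ := norm_sum_le _ _
    _ ≤ ∑ x ∈ blockSites ℓ b, ω * (2 * γ * ‖φ x‖) := Finset.sum_le_sum hterm
    _ = 2 * γ * ∑ x ∈ blockSites ℓ b, ω * ‖φ x‖ := by rw [Finset.mul_sum]; exact Finset.sum_congr rfl fun x _ => by ring

/-- the conjugated plain mean has the norm of the plain mean (`Ad` of a `U1` element is an isometry, lit ✓`norm_conjR`), and the plain mean is bounded by the mean of the norms.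
[cite: Balaban1985BackgroundPropagators, (3.19) p.393] -/
theorem norm_axialMean_le (hV : ∀ x κ, V x κ ∈ U1 𝔸) (lo : Site d) (s : Finset (Site d)) (φ : Site d → 𝔸) {ω : ℝ} (hω : 0 ≤ ω) :
    ‖∑ x ∈ s, ω • conjR (axialFn V lo x) (φ x)‖ ≤ ∑ x ∈ s, ω * ‖φ x‖ := by
  refine (norm_sum_le _ _).trans (le_of_eq (Finset.sum_congr rfl fun x _ => ?_))
  rw [norm_smul, Real.norm_of_nonneg hω, norm_conjR (axialFn_mem hV _ _)]

/-! ## §4 Bondwise: the `Ū`-difference of covariant means against the flat difference of plain∕axial means -/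

/-- ★★ **THE BONDWISE CONVERSION ROW**: coarse bond `(b, μ)`, `b′ = b + e_μ`, both blocks (`ℓ ≥ 1`) inside the cube rooted at `lo`; block transporters `T`, `T′` within `θ` of the corner axial
transporters of `B(b)`, `B(b′)`; (`Ad` is `2`-Lipschitz on `U1`: w4-20520's ✓`Prop7CornerFrameLegsLetters.norm_conjR_sub_conjR_le`); a coarse bond variable `Ū ∈ U1` with `‖Ū − V(x_b; ℓ steps e_μ)‖ ≤ E`.  Then with `u = axialFn V lo`, `Q := Σ_{B(b)} ω•Ad(T x)φ`, `Q′ := Σ_{B(b′)} ω•Ad(T′ x)φ`,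
`A := Σ_{B(b)} ω•Ad(u x)φ`, `A′ := Σ_{B(b′)} ω•Ad(u x)φ`:
`‖(Ad(Ū)Q′ − Q) − Ad(u x_b)⁻¹(A′ − A)‖ ≤ 2(E + ℓ·(d·Rtot)·a)·Σ_{B(b′)} ω‖φ‖ + 2(θ + d(ℓ−1)(dRtot)a)·(Σ_{B(b′)} ω‖φ‖ + Σ_{B(b)} ω‖φ‖)`.
[cite: Balaban1985BackgroundPropagators, (3.19) p.393, (3.24)–(3.26) pp.394–395; Balaban1985Averaging, pp.24–25] -/
theorem norm_covDiff_sub_conj_axialDiff_le (hV : ∀ x κ, V x κ ∈ U1 𝔸) (ha : 0 ≤ a)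
    (hP : ∀ (x : Site d) (κ μ : Fin d), κ ≠ μ → ‖((hol V x (plaqWord κ μ) : 𝔸ˣ) : 𝔸) - 1‖ ≤ a)
    (lo : Site d) {ℓ : ℕ} (hℓ : 1 ≤ ℓ) (b : Site d) (μ : Fin d) (hlo : lo ≤ blockBase ℓ b) {Rtot : ℕ}
    (hR : ∀ x ∈ blockSites ℓ b, ∀ i, x i - lo i ≤ Rtot) (hR' : ∀ x ∈ blockSites ℓ (b + e μ), ∀ i, x i - lo i ≤ Rtot)
    (T T' : Site d → 𝔸ˣ) (hT1 : ∀ x ∈ blockSites ℓ b, T x ∈ U1 𝔸) (hT1' : ∀ x ∈ blockSites ℓ (b + e μ), T' x ∈ U1 𝔸) {θ : ℝ}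
    (hT : ∀ x ∈ blockSites ℓ b, ‖((T x : 𝔸ˣ) : 𝔸) - ((axialFn V (blockBase ℓ b) x : 𝔸ˣ) : 𝔸)‖ ≤ θ)
    (hT' : ∀ x ∈ blockSites ℓ (b + e μ), ‖((T' x : 𝔸ˣ) : 𝔸) - ((axialFn V (blockBase ℓ (b + e μ)) x : 𝔸ˣ) : 𝔸)‖ ≤ θ)
    (Ubar : 𝔸ˣ) (hU1 : Ubar ∈ U1 𝔸) {E : ℝ} (hE : ‖(Ubar : 𝔸) - ((hol V (blockBase ℓ b) (seg μ (ℓ : ℤ)) : 𝔸ˣ) : 𝔸)‖ ≤ E)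
    (φ : Site d → 𝔸) {ω : ℝ} (hω : 0 ≤ ω) :
    ‖(conjR Ubar (∑ x ∈ blockSites ℓ (b + e μ), ω • conjR (T' x) (φ x)) - ∑ x ∈ blockSites ℓ b, ω • conjR (T x) (φ x))
        - conjR (axialFn V lo (blockBase ℓ b))⁻¹
            (∑ x ∈ blockSites ℓ (b + e μ), ω • conjR (axialFn V lo x) (φ x) - ∑ x ∈ blockSites ℓ b, ω • conjR (axialFn V lo x) (φ x))‖
      ≤ 2 * (E + (ℓ : ℝ) * ((d * Rtot) * a)) * ∑ x ∈ blockSites ℓ (b + e μ), ω * ‖φ x‖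
        + 2 * (θ + (d * (ℓ - 1 : ℕ) : ℝ) * ((d * Rtot) * a)) * (∑ x ∈ blockSites ℓ (b + e μ), ω * ‖φ x‖ + ∑ x ∈ blockSites ℓ b, ω * ‖φ x‖) := by
  set xb := blockBase ℓ b with hxb
  set xb' := blockBase ℓ (b + e μ) with hxb'
  set c := axialFn V lo xb with hc
  set c' := axialFn V lo xb' with hc'
  set A := ∑ x ∈ blockSites ℓ b, ω • conjR (axialFn V lo x) (φ x) with hA
  set A' := ∑ x ∈ blockSites ℓ (b + e μ), ω • conjR (axialFn V lo x) (φ x) with hA'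
  set Q := ∑ x ∈ blockSites ℓ b, ω • conjR (T x) (φ x) with hQ
  set Q' := ∑ x ∈ blockSites ℓ (b + e μ), ω • conjR (T' x) (φ x) with hQ'
  set M := ∑ x ∈ blockSites ℓ b, ω * ‖φ x‖ with hM
  set M' := ∑ x ∈ blockSites ℓ (b + e μ), ω * ‖φ x‖ with hM'
  set γ : ℝ := θ + (d * (ℓ - 1 : ℕ) : ℝ) * ((d * Rtot) * a) with hγ
  have hc1 : c ∈ U1 𝔸 := axialFn_mem hV _ _
  have hci : c⁻¹ ∈ U1 𝔸 := (U1 𝔸).inv_mem hc1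
  have hc'1 : c' ∈ U1 𝔸 := axialFn_mem hV _ _
  -- geometry of the two corners
  have hstep : xb' = xb + (ℓ : ℤ) • e μ := by rw [hxb', hxb, blockBase_add_e]
  have hxx : xb ≤ xb' := by
    rw [hstep]; exact le_add_of_nonneg_right fun i => by
      simp only [Pi.smul_apply, Pi.zero_apply, e_apply, smul_eq_mul]; split_ifs <;> simp
  have hlo' : lo ≤ xb' := hlo.trans hxx
  have hmem' : xb' ∈ blockSites ℓ (b + e μ) := blockBase_mem_blockSites' hℓ _
  -- the two pointwise rows
  have hr : ‖Q - conjR c⁻¹ A‖ ≤ 2 * γ * M := norm_covMean_sub_conj_axialMean_le hV ha hP lo ℓ b hlo hR T hT1 hT φ hω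
  have hr' : ‖Q' - conjR c'⁻¹ A'‖ ≤ 2 * γ * M' := norm_covMean_sub_conj_axialMean_le hV ha hP lo ℓ (b + e μ) hlo' hR' T' hT1' hT' φ hω
  -- the transporter `Ū·c′⁻¹` against `c⁻¹`
  have hdiff : ‖((Ubar * c'⁻¹ : 𝔸ˣ) : 𝔸) - ((c⁻¹ : 𝔸ˣ) : 𝔸)‖ ≤ E + (ℓ : ℝ) * ((d * Rtot) * a) := by
    rw [Units.val_mul]
    refine (norm_mul_inv_sub_inv_le hc'1 _).trans ?_
    have hS : ((hol V xb (seg μ (ℓ : ℤ)) : 𝔸ˣ) : 𝔸) = ((axialFn V xb xb' : 𝔸ˣ) : 𝔸) := by rw [hstep, axialFn_add_smul_e]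
    have h10 := norm_inv_axialFn_mul_axialFn_sub_le hV ha hP lo xb xb' hlo hxx (hR' xb' hmem')
    have hl1 : (l1 (xb' - xb) : ℝ) = ℓ := by rw [hstep, add_sub_cancel_left, l1_natCast_smul_e]
    rw [hl1] at h10
    calc _ ≤ ‖(Ubar : 𝔸) - ((hol V xb (seg μ (ℓ : ℤ)) : 𝔸ˣ) : 𝔸)‖ + ‖((hol V xb (seg μ (ℓ : ℤ)) : 𝔸ˣ) : 𝔸) - ((c⁻¹ : 𝔸ˣ) : 𝔸) * (c' : 𝔸)‖ :=
          norm_sub_le_norm_sub_add_norm_sub _ _ _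
      _ ≤ E + (ℓ : ℝ) * ((d * Rtot) * a) := add_le_add hE (by rw [hS, norm_sub_rev, ← Units.val_mul]; exact h10)
  -- the algebra
  have key : (conjR Ubar Q' - Q) - conjR c⁻¹ (A' - A)
      = (conjR (Ubar * c'⁻¹) A' - conjR c⁻¹ A') + conjR Ubar (Q' - conjR c'⁻¹ A') - (Q - conjR c⁻¹ A) := by
    rw [conjR_sub Ubar, conjR_sub c⁻¹, ← conjR_conjR]; abel
  rw [key]
  have hA'le : ‖A'‖ ≤ M' := norm_axialMean_le hV lo _ φ hω
  have h1 : ‖conjR (Ubar * c'⁻¹) A' - conjR c⁻¹ A'‖ ≤ 2 * (E + (ℓ : ℝ) * ((d * Rtot) * a)) * M' := by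
    have hU' : Ubar * c'⁻¹ ∈ U1 𝔸 := (U1 𝔸).mul_mem hU1 ((U1 𝔸).inv_mem hc'1)
    refine (norm_conjR_sub_conjR_le hU' hci A').trans ?_
    have h0 : 0 ≤ E + (ℓ : ℝ) * ((d * Rtot) * a) := (norm_nonneg _).trans hdiff
    exact mul_le_mul (mul_le_mul_of_nonneg_left hdiff (by norm_num)) hA'le (norm_nonneg _) (by positivity)
  have h2 : ‖conjR Ubar (Q' - conjR c'⁻¹ A')‖ ≤ 2 * γ * M' := (norm_conjR_le hU1 _).trans hr'
  calc _ ≤ ‖conjR (Ubar * c'⁻¹) A' - conjR c⁻¹ A'‖ + ‖conjR Ubar (Q' - conjR c'⁻¹ A')‖ + ‖Q - conjR c⁻¹ A‖ :=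
        (norm_sub_le _ _).trans (add_le_add (norm_add_le _ _) le_rfl)
    _ ≤ 2 * (E + (ℓ : ℝ) * ((d * Rtot) * a)) * M' + 2 * γ * M' + 2 * γ * M := add_le_add (add_le_add h1 h2) hr
    _ = _ := by ring

/-! ## §5 Print's comb transporter plugged in: the row for `Q′_k` of (3.19) -/

variable [CompleteSpace 𝔸]

/-- the legs and the composite transporter of print's comb are unit-bounded under the Prop. 2 tower hypotheses (lit ✓`avgIter_mem`, ✓`axialFn_mem`; induction on the levels).
[cite: Balaban1985Averaging, (52)–(54) p.26, (78)–(80) p.30; Balaban1985BackgroundPropagators, (3.19) p.393] -/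
theorem compT_bgT_mem_U1 (L : ℕ) (hL : 2 ≤ L) {G : Subgroup 𝔸ˣ} (hG : AvgClosed d L G)
    (V : Site d → Fin d → 𝔸ˣ) (hV : ∀ x κ, V x κ ∈ G) (k : ℕ) {α₀ : ℝ} (hα : 0 < α₀) (hα3 : C0 d * α₀ ≤ 1 / 3) (hα2 : 2 * α₀ ≤ c2' d L)
    (h52 : pdev V < α₀ * (((L : ℝ) ^ k)⁻¹) ^ 2) :
    ∀ j, j ≤ k → ∀ y x : Site d, compT L (bgT L V) j y x ∈ U1 𝔸
  | 0, _, y, x => by rw [B9B8AveragingKernelZd.compT_zero]; exact (U1 𝔸).one_mem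
  | j + 1, hj, y, x => by
    rw [B9B8AveragingKernelZd.compT_succ]
    refine (U1 𝔸).mul_mem ?_ (compT_bgT_mem_U1 L hL hG V hV k hα hα3 hα2 h52 j (by omega) _ _)
    have hWj : ∀ z κ, avgIter L V j z κ ∈ U1 𝔸 := fun z κ => hG.le_U1 (avgIter_mem L hL hG k V hV hα hα3 hα2 h52 j (by omega) z κ)
    exact axialFn_mem hWj _ _

/-- ★★★ **THE CONVERSION ROW FOR PRINT'S `k`-FOLD COMB MEAN `Q′_k`** ([Balaban1985BackgroundPropagators] (3.19)): under the Prop. 2 tower hypotheses of ✓`norm_compT_bgT_sub_axialFn_le`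
(`L ≥ 2`, `V` in an averaging-closed subgroup `G ≤ U1`, `0 < α₀`, `C₀α₀ ≤ ⅓`, `2α₀ ≤ c₂′`, `pdev V < α₀·L^{−2k}`), for a cube root `lo ≤ Lᵏ·b` with `x − lo ≤ Rtot` on `B^k(b)`:
`‖(Q′_k φ)(b) − Ad(u(Lᵏb))⁻¹(Σ_{B^k(b)} L^{−dk}•Ad(u x)φ x)‖ ≤ 2(87d(d+1)(d+4)α₀ + d(Lᵏ−1)·(d·Rtot)·pdev V)·Σ_{B^k(b)} L^{−dk}‖φ x‖`, `u = axialFn V lo`, the sums over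
the consumer's letter `blockIter L k b` (= `blockSites (Lᵏ) b`, px9 ✓`Prop7TentProfileZd.blockIter_eq_blockSites_pow`).
[cite: Balaban1985BackgroundPropagators, (3.19) p.393; Balaban1985Averaging, (42)–(43) pp.23–24, pp.24–25, (52)–(54) p.26, (78)–(80) p.30] -/
theorem norm_QprimeIter_sub_conj_axialMean_le (L : ℕ) (hL : 2 ≤ L) {G : Subgroup 𝔸ˣ} (hG : AvgClosed d L G)
    (V : Site d → Fin d → 𝔸ˣ) (hV : ∀ x κ, V x κ ∈ G) (k : ℕ) {α₀ : ℝ} (hα : 0 < α₀) (hα3 : C0 d * α₀ ≤ 1 / 3) (hα2 : 2 * α₀ ≤ c2' d L)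
    (h52 : pdev V < α₀ * (((L : ℝ) ^ k)⁻¹) ^ 2)
    (lo b : Site d) (hlo : lo ≤ blockBase (L ^ k) b) {Rtot : ℕ} (hR : ∀ x ∈ blockIter L k b, ∀ i, x i - lo i ≤ Rtot) (φ : Site d → 𝔸) :
    ‖QprimeIter (zdBlocking d L) (bgT L V) k φ b
        - conjR (axialFn V lo (blockBase (L ^ k) b))⁻¹ (∑ x ∈ blockIter L k b, ((((L : ℝ) ^ d)⁻¹) ^ k) • conjR (axialFn V lo x) (φ x))‖
      ≤ 2 * (87 * d * (d + 1) * (d + 4) * α₀ + (d * (L ^ k - 1 : ℕ) : ℝ) * ((d * Rtot) * pdev V))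
          * ∑ x ∈ blockIter L k b, (((L : ℝ) ^ d)⁻¹) ^ k * ‖φ x‖ := by
  haveI : NeZero L := ⟨by omega⟩
  rw [blockIter_eq_blockSites_pow] at hR ⊢
  have hV1 : ∀ x κ, V x κ ∈ U1 𝔸 := fun x κ => hG.le_U1 (hV x κ)
  have hP : ∀ (x : Site d) (κ μ : Fin d), κ ≠ μ → ‖((hol V x (plaqWord κ μ) : 𝔸ˣ) : 𝔸) - 1‖ ≤ pdev V := fun x κ μ _ => le_pdev hV1 x κ μ
  have hT : ∀ x ∈ blockSites (L ^ k) b,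
      ‖((compT L (bgT L V) k b x : 𝔸ˣ) : 𝔸) - ((axialFn V (blockBase (L ^ k) b) x : 𝔸ˣ) : 𝔸)‖ ≤ 87 * d * (d + 1) * (d + 4) * α₀ := fun x hx =>
    norm_compT_bgT_sub_axialFn_le L hL hG V hV k hα hα3 hα2 h52 b x (by rwa [blockIter_eq_blockSites_pow])
  have hT1 : ∀ x ∈ blockSites (L ^ k) b, compT L (bgT L V) k b x ∈ U1 𝔸 := fun x _ =>
    compT_bgT_mem_U1 L hL hG V hV k hα hα3 hα2 h52 k le_rfl b x
  have hω : (0 : ℝ) ≤ (((L : ℝ) ^ d)⁻¹) ^ k := by positivity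
  rw [QprimeIter_zd_eq_sum_blockIter, blockIter_eq_blockSites_pow]
  exact norm_covMean_sub_conj_axialMean_le hV1 (pdev_nonneg V) hP lo (L ^ k) b hlo hR _ hT1 hT φ hω

end Summit.QuantumFields.YangMills.Theorems.Prop7CombVsAxialMeans

end
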